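import Summits.Parity.GeneralizedHardyLittlewood.Theorems.TelescopingWindowsLatticeShift
import Mathlib
import Summits.Parity.Statement
import Summits.Parity.GeneralizedHardyLittlewood.Theses.TelescopingWindows
import Summits.Parity.GeneralizedHardyLittlewood.Theses.SiegelSpectrumSplit

/-!
# TelescopingWindows (route rev 2) — NECESSITY / EXACTNESS package on the BORN decls
(decomp-parity cell, lens-4 g6; no `Prop`-valued defs; dictionary and T15 certificate in
`TelescopingWindowsLatticeShift`).  Node G1.3, guard G2:
`GHL ⟸ BoundedSiegelZeroQuality ∧ WindowMeanStep ∧ ShiftLocalConstancyGivenQ` (sufficiency = the route's `closes`).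
§4 NECESSITY `windowMeanStep_of_ghl`, `shiftLocalConstancyGivenQ_of_ghl` (every window member has size `≤ L + 1`)
and EXACTNESS `node_iff : Q → (GHL ↔ W ∧ LC)`; §5 RECORD REFINEMENT vs `SiegelSpectrumSplit`
(`UQ ∧ LQ ↔ (Q → GHL)`, `UQ ∧ LQ → LC`, `W → LC → UQ ∧ LQ`, `W → ((UQ ∧ LQ) ↔ LC)`); §6 the superseded text of
stmt-Parity-27748 (absolute comparands) implies the born residual (restriction to lattice shifts).
-/

namespace Summit.Parity.GeneralizedHardyLittlewood.TelescopingWindowsLatticeNecessity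

open Finset
open Literature.NumberTheory.Sieve hiding GeneralizedHardyLittlewood
open Summit.Parity.GeneralizedHardyLittlewood.Theses
open Summit.Parity.GeneralizedHardyLittlewood.Theses.TelescopingWindows
open Summit.Parity.GeneralizedHardyLittlewood.TelescopingWindowsLatticeShift
open scoped Classical

noncomputable section

/-! ## §4 Necessity on the BORN decls and exactness of the node -/

/-- `GHL ⟹ WindowMeanStep` (born text, rev 1): each lattice-window member is a non-degenerate system of
size `≤ L + 1`, so its error is `≤ εN^d` by GHL at level `t + 1`; sum over the window. (The induction
hypothesis of the item is not even used.) -/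
theorem windowMeanStep_of_ghl (h : GeneralizedHardyLittlewood) : TelescopingWindows.WindowMeanStep := by
  intro t _ d L hd ε hε
  obtain ⟨N₁, hN₁⟩ := h d (t + 1) (L + 1) hd (Nat.succ_pos t) ε hε
  refine ⟨max N₁ 1, fun N hN Ψ hΨ hL K hK hKN i => ?_⟩
  have hN1 : N₁ ≤ N := le_trans (le_max_left _ _) hN
  have hNone : 1 ≤ N := le_trans (le_max_right _ _) hN
  change |∑ j ∈ latticeWindow ((1 : ℝ) / 8) (strideMod (t + 1) L) Ψ i N,
      hlError (shiftConst Ψ i (j : ℤ)) K N|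
    ≤ ε * ((latticeWindow ((1 : ℝ) / 8) (strideMod (t + 1) L) Ψ i N).card : ℝ) * (N : ℝ) ^ d
  have hterm : ∀ j ∈ latticeWindow ((1 : ℝ) / 8) (strideMod (t + 1) L) Ψ i N,
      |hlError (shiftConst Ψ i (j : ℤ)) K N| ≤ ε * (N : ℝ) ^ d := by
    intro j hj
    obtain ⟨hjlt, -, hjnd⟩ := mem_latticeWindow.mp hj
    have hsz := affLinSize_member_le (θ := (1 : ℝ) / 8) (by norm_num) hNone Ψ i hjlt.le hL
    exact hN₁ N hN1 _ hjnd hsz K hK hKN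
  calc |∑ j ∈ latticeWindow ((1 : ℝ) / 8) (strideMod (t + 1) L) Ψ i N,
          hlError (shiftConst Ψ i (j : ℤ)) K N|
      ≤ ∑ j ∈ latticeWindow ((1 : ℝ) / 8) (strideMod (t + 1) L) Ψ i N,
          |hlError (shiftConst Ψ i (j : ℤ)) K N| := Finset.abs_sum_le_sum_abs _ _
    _ ≤ ∑ j ∈ latticeWindow ((1 : ℝ) / 8) (strideMod (t + 1) L) Ψ i N, ε * (N : ℝ) ^ d :=
        Finset.sum_le_sum hterm
    _ = ε * ((latticeWindow ((1 : ℝ) / 8) (strideMod (t + 1) L) Ψ i N).card : ℝ) * (N : ℝ) ^ d := by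
        rw [Finset.sum_const, nsmul_eq_mul]
        ring

/-- `GHL ⟹ ShiftLocalConstancyGivenQ` (born text, rev 1; triangle inequality; `Q` is not used). -/
theorem shiftLocalConstancyGivenQ_of_ghl (h : GeneralizedHardyLittlewood) :
    TelescopingWindows.ShiftLocalConstancyGivenQ := by
  intro _ d t L hd ht ε hε
  obtain ⟨N₀, hN₀⟩ := h d t (L + 1) hd ht (ε / 2) (by positivity)
  refine ⟨max N₀ 1, fun N hN Ψ hΨ hL K hK hKN i j hj _ hjnd => ?_⟩
  have hN0 : N₀ ≤ N := le_trans (le_max_left _ _) hN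
  have hNone : 1 ≤ N := le_trans (le_max_right _ _) hN
  change |hlError Ψ K N - hlError (shiftConst Ψ i (j : ℤ)) K N| ≤ ε * (N : ℝ) ^ d
  have hLup : affLinSize Ψ N ≤ ((L + 1 : ℕ) : ℝ) := hL.trans (by push_cast; linarith)
  have h1 : |hlError Ψ K N| ≤ ε / 2 * (N : ℝ) ^ d := hN₀ N hN0 Ψ hΨ hLup K hK hKN
  have hsz := affLinSize_member_le (θ := (1 : ℝ) / 8) (by norm_num) hNone Ψ i hj hL
  have h2 : |hlError (shiftConst Ψ i (j : ℤ)) K N| ≤ ε / 2 * (N : ℝ) ^ d :=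
    hN₀ N hN0 _ hjnd hsz K hK hKN
  calc |hlError Ψ K N - hlError (shiftConst Ψ i (j : ℤ)) K N|
      ≤ |hlError Ψ K N| + |hlError (shiftConst Ψ i (j : ℤ)) K N| := by
        simpa [sub_eq_add_neg, abs_neg] using
          abs_add_le (hlError Ψ K N) (-hlError (shiftConst Ψ i (j : ℤ)) K N)
    _ ≤ ε / 2 * (N : ℝ) ^ d + ε / 2 * (N : ℝ) ^ d := add_le_add h1 h2
    _ = ε * (N : ℝ) ^ d := by ring

/-- **EXACTNESS of the node (born decls).**  Given `Q`:  `GHL ⟺ WindowMeanStep ∧ ShiftLocalConstancyGivenQ`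
(`←` is the route file's `closes`). -/
theorem node_iff (hQ : TelescopingWindows.BoundedSiegelZeroQuality) :
    GeneralizedHardyLittlewood ↔
      (TelescopingWindows.WindowMeanStep ∧ TelescopingWindows.ShiftLocalConstancyGivenQ) :=
  ⟨fun h => ⟨windowMeanStep_of_ghl h, shiftLocalConstancyGivenQ_of_ghl h⟩,
    fun h => TelescopingWindows.closes hQ h.1 h.2⟩

/-! ## §5 Refinement of the tree of record (`route-Parity-SiegelSpectrumSplit`) -/

/-- The shared item is literally the record's `Q`. -/
theorem boundedSiegelZeroQuality_iff_record :
    TelescopingWindows.BoundedSiegelZeroQuality ↔ SiegelSpectrumSplit.BoundedSiegelZeroQuality :=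
  Iff.rfl

/-- The record residual `UQ ∧ LQ` is exactly `Q → GHL`. -/
theorem record_residual_iff :
    (SiegelSpectrumSplit.UpperGivenBoundedSiegel ∧ SiegelSpectrumSplit.LowerGivenBoundedSiegel)
      ↔ (SiegelSpectrumSplit.BoundedSiegelZeroQuality → GeneralizedHardyLittlewood) := by
  constructor
  · rintro ⟨hU, hL⟩ hQ
    exact SiegelSpectrumSplit.closes hQ hU hL
  · intro h
    refine ⟨fun hQ d t L hd ht ε hε => ?_, fun hQ d t L hd ht ε hε => ?_⟩
    · obtain ⟨N₀, hN₀⟩ := h hQ d t L hd ht ε hε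
      exact ⟨N₀, fun N hN Ψ hΨ hΨL K hK hKN =>
        (le_abs_self _).trans (hN₀ N hN Ψ hΨ hΨL K hK hKN)⟩
    · obtain ⟨N₀, hN₀⟩ := h hQ d t L hd ht ε hε
      refine ⟨N₀, fun N hN Ψ hΨ hΨL K hK hKN => ?_⟩
      have h' := hN₀ N hN Ψ hΨ hΨL K hK hKN
      rw [abs_sub_comm] at h'
      exact (le_abs_self _).trans h'

/-- `UQ ∧ LQ ⟹ ShiftLocalConstancyGivenQ` outright (the born residual is BELOW the record residual). -/
theorem shiftLocalConstancyGivenQ_of_record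
    (h : SiegelSpectrumSplit.UpperGivenBoundedSiegel ∧ SiegelSpectrumSplit.LowerGivenBoundedSiegel) :
    TelescopingWindows.ShiftLocalConstancyGivenQ := fun hQ =>
  shiftLocalConstancyGivenQ_of_ghl (record_residual_iff.mp h hQ) hQ

/-- The node closes the record's residual slots: `W → LC → UQ ∧ LQ`. -/
theorem record_residual_of_node (hW : TelescopingWindows.WindowMeanStep)
    (hC : TelescopingWindows.ShiftLocalConstancyGivenQ) :
    SiegelSpectrumSplit.UpperGivenBoundedSiegel ∧ SiegelSpectrumSplit.LowerGivenBoundedSiegel :=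
  record_residual_iff.mpr fun hQ => TelescopingWindows.closes hQ hW hC

/-- **Record refinement.**  Given `WindowMeanStep`, the record residual and the born residual are EQUIVALENT. -/
theorem record_refinement (hW : TelescopingWindows.WindowMeanStep) :
    (SiegelSpectrumSplit.UpperGivenBoundedSiegel ∧ SiegelSpectrumSplit.LowerGivenBoundedSiegel)
      ↔ TelescopingWindows.ShiftLocalConstancyGivenQ :=
  ⟨shiftLocalConstancyGivenQ_of_record, record_residual_of_node hW⟩

/-! ## §6 The refuted→repaired edge: the SUPERSEDED text of stmt-Parity-27748 implies the born residual -/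

/-- Old ⟹ new: the superseded residual (absolute comparands at EVERY shift `j ≤ N^{1/8}`, text of
stmt-Parity-27748 verbatim as hypothesis) implies the born one (restriction to lattice shifts). -/
theorem shiftLocalConstancyGivenQ_of_superseded
    (h : (∃ η₀ : ℝ, ∃ q₀ : ℕ, ∀ (q : ℕ) [NeZero q] (χ : DirichletCharacter ℂ q) (η : ℝ), q₀ ≤ q → Literature.Barriers.Parity.IsSiegelZero χ η → η < η₀) → ∀ (d t L : ℕ), 1 ≤ d → 1 ≤ t → ∀ ε : ℝ, 0 < ε → ∃ N₀ : ℕ, ∀ N : ℕ, N₀ ≤ N → ∀ Ψ : Fin t → Literature.NumberTheory.Sieve.AffLinForm d, Literature.NumberTheory.Sieve.IsNondegenerateSystem Ψ → Literature.NumberTheory.Sieve.affLinSize Ψ N ≤ L → ∀ K : Set (Fin d → ℝ), Convex ℝ K → K ⊆ Literature.NumberTheory.Sieve.realBox d N → ∀ i : Fin t, ∀ j : ℕ, j ≤ ⌊(N : ℝ) ^ ((1 : ℝ) / 8)⌋₊ → Literature.NumberTheory.Sieve.IsNondegenerateSystem (Function.update Ψ i (⟨(Ψ i).coeff, (Ψ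 i).const + (j : ℤ)⟩ : Literature.NumberTheory.Sieve.AffLinForm d)) → |(Literature.NumberTheory.Sieve.vonMangoldtSum Ψ K N - Literature.NumberTheory.Sieve.archFactor Ψ K * Literature.NumberTheory.Sieve.singularProduct Ψ) - (Literature.NumberTheory.Sieve.vonMangoldtSum (Function.update Ψ i (⟨(Ψ i).coeff, (Ψ i).const + (j : ℤ)⟩ : Literature.NumberTheory.Sieve.AffLinForm d)) K N - Literature.NumberTheory.Sieve.archFactor (Function.update Ψ i (⟨(Ψ i).coeff, (Ψ i).const + (j : ℤ)⟩ : Literature.NumberTheory.Sieve.AffLinForm d)) K * Literature.NumberTheory.Sieve.singularProduct (Function.update Ψ i (⟨(Ψ i).coeff, (Ψ i).const + (j : ℤ)⟩ : Literature.NumberTheory.Sieve.AffLinForm d)))| ≤ ε * (N : ℝ) ^ d) :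
    TelescopingWindows.ShiftLocalConstancyGivenQ := by
  intro hQ d t L hd ht ε hε
  obtain ⟨N₀, hN₀⟩ := h hQ d t L hd ht ε hε
  exact ⟨N₀, fun N hN Ψ hΨ hL K hK hKN i j hj _ hjnd => hN₀ N hN Ψ hΨ hL K hK hKN i j hj hjnd⟩

end

end Summit.Parity.GeneralizedHardyLittlewood.TelescopingWindowsLatticeNecessity
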